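import Literature.Analysis.FluidPDE.TorusNSVectorFieldGevrey
import Literature.Analysis.FluidPDE.TorusNSVectorFieldHolder
import HarnessLib

/-!
# Uniform `L²`-continuity, on Gevrey balls of `T³`, of the Navier–Stokes vector field and of the
# second time derivative `E(u, G(u))`

Analysis/FluidPDE proof file (theorems only; no definitions, no named facts). With the pressure solved,
a classical solution of NS_ν on `T³` satisfies `∂ₜu = G(u) = νΔu − P((u·∇)u) + f` and
`∂ₜ²u = E(u, ∂ₜu)`, `E(u, w) = νΔw − P((u·∇)w + (w·∇)u)` (`FluidPDE/TorusNSVectorFieldGevrey.lean`). On a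
**Gevrey ball** (the sets `{∑_{k∈S} e^{2σ|k|} ‖û(k)‖² ≤ C}` reached by every classical trajectory after a
warm-up, Foias–Temam 1989) these fields depend continuously on the state **in `L²`, uniformly**:

* `Torus.exists_integral_norm_sq_linearisedField_sub_le` — the `L²`-Lipschitz estimate
  `∫‖E(u₁,w₁) − E(u₂,w₂)‖² ≤ K (∫‖Δδw‖² + ‖∇δw‖₂² + ∫‖δw‖² + ‖∇δu‖₂² + ∫‖δu‖²)`, `δu = u₁ − u₂`,
  `δw = w₁ − w₂`, on Gevrey balls (every `d`): the difference is `νΔδw − P V`,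
  `V = [(u₁·∇)δw + (δw·∇)u₁] + [(w₂·∇)δu + (δu·∇)w₂]`, `P` is an `L²`-contraction
  (`Torus.integral_norm_sq_leray_sub_le`) and each bracket is bounded by sup norms (Gevrey,
  `Torus.exists_sobolevBounds_of_gevreyBound`) times `H¹` norms (`Torus.integral_norm_sq_convect_add_convect_le`,
  Temam 1997 (6.17));
* `Torus.exists_forall_l2_nsVectorField_sub_le` (`card d = 3`) — `u ↦ G(u)` is uniformly continuous
  `L² → L²` on Gevrey balls of zero-mean fields (the Hölder estimate
  `Torus.exists_h1_nsVectorField_sub_le_sqrt_of_gevreyBound` and the Gevrey interpolation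
  `Torus.exists_forall_h2_sub_le_of_gevreyBound`);
* `Torus.exists_forall_l2_linearisedField_sub_le` — `(u, w) ↦ E(u, w)` is uniformly continuous
  `L² × L² → L²` on Gevrey balls;
* `Torus.exists_forall_nsTimeDerivFields_sub_le` (`card d = 3`) — **the two time-derivative fields
  `w = G(u)` and `E(u, w)` and their Laplacians are uniformly `L²`-continuous functions of the state on a
  Gevrey ball**: for `ε > 0` there is `δ > 0` with `∫‖w₁ − w₂‖², ∫‖Δ(w₁ − w₂)‖², ∫‖E₁ − E₂‖²,
  ∫‖Δ(E₁ − E₂)‖² ≤ ε` whenever `∫‖u₁ − u₂‖² ≤ δ` (`G`, `E` map Gevrey balls into Gevrey balls,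
  `Torus.exists_gevreyBound_nsVectorField` / `…_linearisedField`, so `L²`-smallness upgrades to
  `H²`-smallness by interpolation). This is the continuity in `H` (indeed in every `H^m`) of
  `t ↦ u'(t), u''(t)` along and across strong solutions (Constantin–Foias 1988, Ch. 10–11; Temam 1995 §3.4).

## Mathlib / tree search

Tree (reused): `TorusNSVectorFieldGevrey`, `TorusNSVectorFieldHolder`, `TorusNSGevreyAlgebra`,
`TorusClassicalNSDifferenceBalances` (`integral_norm_sq_convect_add_convect_le`), `TorusLerayHelmholtzH1`,
`TorusGevreySobolevBounds`. Searched `linearisedField`, `nsVectorField.*continuous`, `secondTimeDeriv`: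
only the `H¹`-Hölder estimate of `G` (T3) exists.

## References

* P. Constantin, C. Foias, *Navier–Stokes Equations*, Univ. Chicago Press 1988, Ch. 10–11. [ConstantinFoiasNSE1988]
* R. Temam, *Infinite-Dimensional Dynamical Systems in Mechanics and Physics*, 2nd ed., Springer 1997,
  Ch. III §6.2 (6.16)–(6.17). [Temam1997]
* C. Foias, R. Temam, J. Funct. Anal. 87 (1989) 359–369. [FoiasTemam1989]
-/

noncomputable section

open _root_.MeasureTheory Set Filter Function UnitAddTorus Finset
open scoped Topology BigOperators InnerProductSpace

namespace Literature.Analysis.FluidPDE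

namespace Torus

open Literature.Analysis.FunctionSpaces Literature.Analysis.FunctionSpaces.Torus NSGevrey

variable {d : Type*} [Fintype d] [DecidableEq d]

/-! ### The `L²`-Lipschitz estimate of the linearised field -/

section Lipschitz

variable {u₁ u₂ w₁ w₂ : UnitAddTorus d → EuclideanSpace ℝ d}

omit [DecidableEq d] in
/-- **Algebra of the difference of two linearised inertial terms**: with `δu = u₁ − u₂`, `δw = w₁ − w₂`,
`[(u₁·∇)w₁ + (w₁·∇)u₁] − [(u₂·∇)w₂ + (w₂·∇)u₂] = [(u₁·∇)δw + (δw·∇)u₁] + [(w₂·∇)δu + (δu·∇)w₂]`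
pointwise (bilinearity of `(·∇)·`). [folklore] -/
theorem linearisedInertial_sub_apply (hu₁ : IsSmooth u₁) (hu₂ : IsSmooth u₂) (hw₁ : IsSmooth w₁)
    (hw₂ : IsSmooth w₂) (x : UnitAddTorus d) :
    (convect u₁ w₁ x + convect w₁ u₁ x) - (convect u₂ w₂ x + convect w₂ u₂ x) =
      (convect u₁ (fun y => w₁ y - w₂ y) x + convect (fun y => w₁ y - w₂ y) u₁ x) +
        (convect w₂ (fun y => u₁ y - u₂ y) x + convect (fun y => u₁ y - u₂ y) w₂ x) := by
  have h1 : IsContDiff 1 u₁ := hu₁.isContDiff (by simp)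
  have h2 : IsContDiff 1 u₂ := hu₂.isContDiff (by simp)
  have h3 : IsContDiff 1 w₁ := hw₁.isContDiff (by simp)
  have h4 : IsContDiff 1 w₂ := hw₂.isContDiff (by simp)
  have hδu : (fun y => u₁ y - u₂ y) = u₁ - u₂ := rfl
  have hδw : (fun y => w₁ y - w₂ y) = w₁ - w₂ := rfl
  simp only [convect, hδu, hδw, Torus.fderiv_sub h1 h2, Torus.fderiv_sub h3 h4, FunLike.coe_sub,
    Pi.sub_apply, map_sub]
  abel

/-- **The `L²`-Lipschitz estimate of the linearised field on Gevrey balls** (every `d`): for `ν`,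
`σ > 0`, `C_u`, `C_w` there is `K ≥ 0` such that for all smooth `u₁, u₂` with Gevrey bounds
`(σ, C_u)` and smooth `w₁, w₂` with Gevrey bounds `(σ, C_w)`,
`∫ ‖E(u₁, w₁) − E(u₂, w₂)‖² ≤ K (∫‖Δδw‖² + ‖∇δw‖₂² + ∫‖δw‖² + ‖∇δu‖₂² + ∫‖δu‖²)`,
`E(u, w) = νΔw − P((u·∇)w + (w·∇)u)`, `δu = u₁ − u₂`, `δw = w₁ − w₂`: the difference is `νΔδw − (P N₁ − P N₂)`,
`∫‖P N₁ − P N₂‖² ≤ ∫‖N₁ − N₂‖²` (`Torus.integral_norm_sq_leray_sub_le`), and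
`N₁ − N₂ = [(u₁·∇)δw + (δw·∇)u₁] + [(w₂·∇)δu + (δu·∇)w₂]` is bounded in `L²` by
`Torus.integral_norm_sq_convect_add_convect_le` with the Gevrey sup bounds of `u₁`, `w₂`
(Temam 1997, (6.17)). [cite: Temam1997, Ch. III §6.2 (6.16)–(6.17)] -/
theorem exists_integral_norm_sq_linearisedField_sub_le [Nonempty d] (ν σ Cu Cw : ℝ) (hσ : 0 < σ) :
    ∃ K : ℝ, 0 ≤ K ∧ ∀ (u₁ u₂ w₁ w₂ : UnitAddTorus d → EuclideanSpace ℝ d), IsSmooth u₁ → IsSmooth u₂ →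
      IsSmooth w₁ → IsSmooth w₂ →
      (∀ S : Finset (d → ℤ), ∑ k ∈ S, Real.exp (2 * σ * Real.sqrt (freqNormSq k)) *
        ‖mFourierCoeff (EuclideanSpace.complexify ∘ u₁) k‖ ^ 2 ≤ Cu) →
      (∀ S : Finset (d → ℤ), ∑ k ∈ S, Real.exp (2 * σ * Real.sqrt (freqNormSq k)) *
        ‖mFourierCoeff (EuclideanSpace.complexify ∘ u₂) k‖ ^ 2 ≤ Cu) →
      (∀ S : Finset (d → ℤ), ∑ k ∈ S, Real.exp (2 * σ * Real.sqrt (freqNormSq k)) *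
        ‖mFourierCoeff (EuclideanSpace.complexify ∘ w₁) k‖ ^ 2 ≤ Cw) →
      (∀ S : Finset (d → ℤ), ∑ k ∈ S, Real.exp (2 * σ * Real.sqrt (freqNormSq k)) *
        ‖mFourierCoeff (EuclideanSpace.complexify ∘ w₂) k‖ ^ 2 ≤ Cw) →
      (∫ x, ‖(ν • laplacian w₁ x - ((convect u₁ w₁ x + convect w₁ u₁ x) -
          Torus.gradient (invLaplacian (divergence fun y => convect u₁ w₁ y + convect w₁ u₁ y)) x)) -
        (ν • laplacian w₂ x - ((convect u₂ w₂ x + convect w₂ u₂ x) -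
          Torus.gradient (invLaplacian (divergence fun y => convect u₂ w₂ y + convect w₂ u₂ y)) x))‖ ^ 2) ≤
      K * ((∫ x, ‖laplacian (fun y => w₁ y - w₂ y) x‖ ^ 2) + gradNormSq (fun y => w₁ y - w₂ y) +
        (∫ x, ‖w₁ x - w₂ x‖ ^ 2) + gradNormSq (fun y => u₁ y - u₂ y) + ∫ x, ‖u₁ x - u₂ x‖ ^ 2) := by
  obtain ⟨Bu, hBu⟩ := exists_sobolevBounds_of_gevreyBound (d := d) hσ Cu
  obtain ⟨Bw, hBw⟩ := exists_sobolevBounds_of_gevreyBound (d := d) hσ Cw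
  set K : ℝ := 2 * ν ^ 2 + 4 * (2 * (Fintype.card d * Bu ^ 2) + 2 * (Fintype.card d * Bu) ^ 2) +
    4 * (2 * (Fintype.card d * Bw ^ 2) + 2 * (Fintype.card d * Bw) ^ 2) with hK
  have hK0 : 0 ≤ K := by positivity
  refine ⟨K, hK0, fun u₁ u₂ w₁ w₂ hu₁ hu₂ hw₁ hw₂ hGu₁ _ _ hGw₂ => ?_⟩
  obtain ⟨hMu, hDu, -⟩ := hBu u₁ hu₁ hGu₁
  obtain ⟨hMw, hDw, -⟩ := hBw w₂ hw₂ hGw₂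
  -- the fields
  set δu : UnitAddTorus d → EuclideanSpace ℝ d := fun y => u₁ y - u₂ y with hδu
  set δw : UnitAddTorus d → EuclideanSpace ℝ d := fun y => w₁ y - w₂ y with hδw
  have hδus : IsSmooth δu := hu₁.sub hu₂
  have hδws : IsSmooth δw := hw₁.sub hw₂
  set N₁ : UnitAddTorus d → EuclideanSpace ℝ d := fun y => convect u₁ w₁ y + convect w₁ u₁ y with hN₁
  set N₂ : UnitAddTorus d → EuclideanSpace ℝ d := fun y => convect u₂ w₂ y + convect w₂ u₂ y with hN₂
  have hN₁s : IsSmooth N₁ := (hu₁.convect hw₁).add (hw₁.convect hu₁)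
  have hN₂s : IsSmooth N₂ := (hu₂.convect hw₂).add (hw₂.convect hu₂)
  set P₁ : UnitAddTorus d → EuclideanSpace ℝ d := fun x => N₁ x - Torus.gradient (invLaplacian (divergence N₁)) x
    with hP₁
  set P₂ : UnitAddTorus d → EuclideanSpace ℝ d := fun x => N₂ x - Torus.gradient (invLaplacian (divergence N₂)) x
    with hP₂
  have hP₁s : IsSmooth P₁ := isSmooth_sub_gradient_invLaplacian_divergence hN₁s
  have hP₂s : IsSmooth P₂ := isSmooth_sub_gradient_invLaplacian_divergence hN₂s
  set br₁ : UnitAddTorus d → EuclideanSpace ℝ d := fun x => convect u₁ δw x + convect δw u₁ x with hbr₁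
  set br₂ : UnitAddTorus d → EuclideanSpace ℝ d := fun x => convect w₂ δu x + convect δu w₂ x with hbr₂
  have hbr₁s : IsSmooth br₁ := (hu₁.convect hδws).add (hδws.convect hu₁)
  have hbr₂s : IsSmooth br₂ := (hw₂.convect hδus).add (hδus.convect hw₂)
  -- Step 1: the integrand is `ν • Δδw - (P₁ - P₂)`
  have hΔ : ∀ x, laplacian δw x = laplacian w₁ x - laplacian w₂ x := fun x => by
    rw [hδw, show (fun y => w₁ y - w₂ y) = w₁ - w₂ from rfl, laplacian_sub hw₁ hw₂, Pi.sub_apply]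
  have hpt : ∀ x, (ν • laplacian w₁ x - P₁ x) - (ν • laplacian w₂ x - P₂ x) =
      ν • laplacian δw x - (P₁ x - P₂ x) := fun x => by rw [hΔ x, smul_sub]; abel
  have hstep1 : ∫ x, ‖(ν • laplacian w₁ x - P₁ x) - (ν • laplacian w₂ x - P₂ x)‖ ^ 2 ≤
      2 * (ν ^ 2 * ∫ x, ‖laplacian δw x‖ ^ 2) + 2 * ∫ x, ‖P₁ x - P₂ x‖ ^ 2 := by
    have h := integral_norm_sq_fun_sub_le (f := fun x => ν • laplacian δw x) (g := fun x => P₁ x - P₂ x)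
      (hδws.laplacian.smul ν) (hP₁s.sub hP₂s)
    beta_reduce at h
    rw [integral_norm_sq_const_smul] at h
    calc ∫ x, ‖(ν • laplacian w₁ x - P₁ x) - (ν • laplacian w₂ x - P₂ x)‖ ^ 2
        = ∫ x, ‖ν • laplacian δw x - (P₁ x - P₂ x)‖ ^ 2 := by simp_rw [hpt]
      _ ≤ _ := h
  -- Step 2: `∫‖P₁ - P₂‖² ≤ ∫‖N₁ - N₂‖² = ∫‖br₁ + br₂‖² ≤ 2∫‖br₁‖² + 2∫‖br₂‖²`
  have hstep2 : ∫ x, ‖P₁ x - P₂ x‖ ^ 2 ≤ 2 * (∫ x, ‖br₁ x‖ ^ 2) + 2 * ∫ x, ‖br₂ x‖ ^ 2 := by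
    have hle := integral_norm_sq_leray_sub_le hN₁s hN₂s
    have heq : ∀ x, N₁ x - N₂ x = br₁ x + br₂ x := fun x => linearisedInertial_sub_apply hu₁ hu₂ hw₁ hw₂ x
    have hpt2 : ∀ x, ‖br₁ x + br₂ x‖ ^ 2 ≤ 2 * ‖br₁ x‖ ^ 2 + 2 * ‖br₂ x‖ ^ 2 := fun x => by
      have h := norm_add_le (br₁ x) (br₂ x)
      nlinarith [norm_nonneg (br₁ x + br₂ x), norm_nonneg (br₁ x), norm_nonneg (br₂ x),
        sq_nonneg (‖br₁ x‖ - ‖br₂ x‖)]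
    calc ∫ x, ‖P₁ x - P₂ x‖ ^ 2 ≤ ∫ x, ‖N₁ x - N₂ x‖ ^ 2 := hle
      _ = ∫ x, ‖br₁ x + br₂ x‖ ^ 2 := by simp_rw [heq]
      _ ≤ ∫ x, (2 * ‖br₁ x‖ ^ 2 + 2 * ‖br₂ x‖ ^ 2) :=
          integral_mono (hbr₁s.add hbr₂s).norm_sq.integrable
            ((hbr₁s.norm_sq.integrable.const_mul 2).add (hbr₂s.norm_sq.integrable.const_mul 2)) hpt2
      _ = 2 * (∫ x, ‖br₁ x‖ ^ 2) + 2 * ∫ x, ‖br₂ x‖ ^ 2 := by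
          rw [integral_add (hbr₁s.norm_sq.integrable.const_mul 2) (hbr₂s.norm_sq.integrable.const_mul 2),
            integral_const_mul, integral_const_mul]
  -- Step 3: the brackets by sup × `H¹`
  have hb₁ : ∫ x, ‖br₁ x‖ ^ 2 ≤ 2 * (Fintype.card d * Bu ^ 2) * gradNormSq δw +
      2 * (Fintype.card d * Bu) ^ 2 * ∫ x, ‖δw x‖ ^ 2 := by
    have h := integral_norm_sq_convect_add_convect_le (u₁ := u₁) hu₁ hδws hMu (C := fun _ => Bu) fun i x => hDu i x
    rwa [Finset.sum_const, Finset.card_univ, nsmul_eq_mul] at h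
  have hb₂ : ∫ x, ‖br₂ x‖ ^ 2 ≤ 2 * (Fintype.card d * Bw ^ 2) * gradNormSq δu +
      2 * (Fintype.card d * Bw) ^ 2 * ∫ x, ‖δu x‖ ^ 2 := by
    have h := integral_norm_sq_convect_add_convect_le (u₁ := w₂) hw₂ hδus hMw (C := fun _ => Bw) fun i x => hDw i x
    rwa [Finset.sum_const, Finset.card_univ, nsmul_eq_mul] at h
  -- bookkeeping
  have hY0 : 0 ≤ ∫ x, ‖laplacian δw x‖ ^ 2 := integral_nonneg fun x => sq_nonneg _
  have hEw0 : 0 ≤ gradNormSq δw := gradNormSq_nonneg _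
  have hLw0 : 0 ≤ ∫ x, ‖δw x‖ ^ 2 := integral_nonneg fun x => sq_nonneg _
  have hEu0 : 0 ≤ gradNormSq δu := gradNormSq_nonneg _
  have hLu0 : 0 ≤ ∫ x, ‖δu x‖ ^ 2 := integral_nonneg fun x => sq_nonneg _
  have hmain : ∫ x, ‖(ν • laplacian w₁ x - P₁ x) - (ν • laplacian w₂ x - P₂ x)‖ ^ 2 ≤
      K * ((∫ x, ‖laplacian δw x‖ ^ 2) + gradNormSq δw + (∫ x, ‖δw x‖ ^ 2) + gradNormSq δu + ∫ x, ‖δu x‖ ^ 2) := by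
    have hA : 0 ≤ 2 * (Fintype.card d * Bu ^ 2) + 2 * (Fintype.card d * Bu) ^ 2 := by positivity
    have hB : 0 ≤ 2 * (Fintype.card d * Bw ^ 2) + 2 * (Fintype.card d * Bw) ^ 2 := by positivity
    rw [hK]
    nlinarith [hstep1, hstep2, hb₁, hb₂, sq_nonneg ν, mul_nonneg hA hEw0, mul_nonneg hA hLw0, mul_nonneg hB hEu0,
      mul_nonneg hB hLu0, mul_nonneg hA hY0, mul_nonneg hB hY0, mul_nonneg (sq_nonneg ν) hEw0,
      mul_nonneg (sq_nonneg ν) hLw0, mul_nonneg (sq_nonneg ν) hEu0, mul_nonneg (sq_nonneg ν) hLu0,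
      mul_nonneg hA hEu0, mul_nonneg hA hLu0, mul_nonneg hB hEw0, mul_nonneg hB hLw0]
  exact hmain

end Lipschitz

/-! ### Uniform `L²`-continuity of `G` and `E` on Gevrey balls -/

section Continuity

/-- **`u ↦ G(u)` is uniformly `L² → L²` continuous on Gevrey balls of zero-mean fields of `T³`**: on
`T^d` with `card d = 3`, for `ν`, `σ > 0`, `C` and `ε > 0` there is `δ > 0` such that any two smooth
zero-mean `u₁, u₂` with Gevrey bounds `(σ, C)` and `∫‖u₁ − u₂‖² ≤ δ` satisfy
`∫‖G(u₁) − G(u₂)‖² ≤ ε`, `G(u) = νΔu − P((u·∇)u)` (the Hölder estimate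
`Torus.exists_h1_nsVectorField_sub_le_sqrt_of_gevreyBound` and `Torus.exists_forall_h2_sub_le_of_gevreyBound`).
[folklore] -/
theorem exists_forall_l2_nsVectorField_sub_le (hd : Fintype.card d = 3) (ν σ C : ℝ) (hσ : 0 < σ) {ε : ℝ}
    (hε : 0 < ε) :
    ∃ δ : ℝ, 0 < δ ∧ ∀ (u₁ u₂ : UnitAddTorus d → EuclideanSpace ℝ d), IsSmooth u₁ → IsSmooth u₂ →
      HasZeroMean u₁ → HasZeroMean u₂ →
      (∀ S : Finset (d → ℤ), ∑ k ∈ S, Real.exp (2 * σ * Real.sqrt (freqNormSq k)) *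
        ‖mFourierCoeff (EuclideanSpace.complexify ∘ u₁) k‖ ^ 2 ≤ C) →
      (∀ S : Finset (d → ℤ), ∑ k ∈ S, Real.exp (2 * σ * Real.sqrt (freqNormSq k)) *
        ‖mFourierCoeff (EuclideanSpace.complexify ∘ u₂) k‖ ^ 2 ≤ C) →
      (∫ x, ‖u₁ x - u₂ x‖ ^ 2) ≤ δ →
      (∫ x, ‖(ν • laplacian u₁ x - (convect u₁ u₁ x - Torus.gradient (invLaplacian (divergence (convect u₁ u₁))) x)) -
          (ν • laplacian u₂ x - (convect u₂ u₂ x - Torus.gradient (invLaplacian (divergence (convect u₂ u₂))) x))‖ ^ 2)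
        ≤ ε := by
  obtain ⟨K, hK⟩ := exists_h1_nsVectorField_sub_le_sqrt_of_gevreyBound hd ν σ C hσ
  set K' : ℝ := |K| + 1 with hK'
  have hK'0 : 0 < K' := by positivity
  have hη : 0 < (ε / K') ^ 2 / 2 := by positivity
  obtain ⟨δA, hδA, hA⟩ := exists_forall_h2_sub_le_of_gevreyBound (d := d) σ C hσ hη
  refine ⟨min δA ((ε / K') ^ 2 / 2), lt_min hδA hη, fun u₁ u₂ hu₁ hu₂ hm₁ hm₂ hG₁ hG₂ hL2 => ?_⟩
  have hgrad := (hA u₁ u₂ hu₁ hu₂ hG₁ hG₂ (hL2.trans (min_le_left _ _))).1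
  have hh : (∫ x, ‖u₁ x - u₂ x‖ ^ 2) + gradNormSq (u₁ - u₂) ≤ (ε / K') ^ 2 := by
    have h1 := hL2.trans (min_le_right _ _)
    have h2 : gradNormSq (u₁ - u₂) ≤ (ε / K') ^ 2 / 2 := hgrad
    linarith
  have hh0 : 0 ≤ (∫ x, ‖u₁ x - u₂ x‖ ^ 2) + gradNormSq (u₁ - u₂) :=
    add_nonneg (integral_nonneg fun x => sq_nonneg _) (gradNormSq_nonneg _)
  have hsqrt : Real.sqrt ((∫ x, ‖u₁ x - u₂ x‖ ^ 2) + gradNormSq (u₁ - u₂)) ≤ ε / K' := by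
    rw [← Real.sqrt_sq (by positivity : 0 ≤ ε / K')]
    exact Real.sqrt_le_sqrt hh
  have hT3 := hK u₁ u₂ hu₁ hu₂ hm₁ hm₂ hG₁ hG₂
  have hG0 := gradNormSq_nonneg (fun x => (ν • laplacian u₁ x -
      (convect u₁ u₁ x - Torus.gradient (invLaplacian (divergence (convect u₁ u₁))) x)) -
    (ν • laplacian u₂ x - (convect u₂ u₂ x - Torus.gradient (invLaplacian (divergence (convect u₂ u₂))) x)))
  have hKK : K * Real.sqrt ((∫ x, ‖u₁ x - u₂ x‖ ^ 2) + gradNormSq (u₁ - u₂)) ≤ ε := by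
    calc K * Real.sqrt ((∫ x, ‖u₁ x - u₂ x‖ ^ 2) + gradNormSq (u₁ - u₂))
        ≤ K' * Real.sqrt ((∫ x, ‖u₁ x - u₂ x‖ ^ 2) + gradNormSq (u₁ - u₂)) :=
          mul_le_mul_of_nonneg_right (by rw [hK']; linarith [le_abs_self K]) (Real.sqrt_nonneg _)
      _ ≤ K' * (ε / K') := mul_le_mul_of_nonneg_left hsqrt hK'0.le
      _ = ε := by field_simp
  linarith

/-- **`(u, w) ↦ E(u, w)` is uniformly `L² × L² → L²` continuous on Gevrey balls** (every `d`): for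
`ν`, `σ > 0`, `C_u`, `C_w` and `ε > 0` there is `δ > 0` such that smooth `u₁, u₂` with Gevrey bounds
`(σ, C_u)` and smooth `w₁, w₂` with Gevrey bounds `(σ, C_w)`, `∫‖u₁ − u₂‖² ≤ δ`, `∫‖w₁ − w₂‖² ≤ δ`,
satisfy `∫‖E(u₁, w₁) − E(u₂, w₂)‖² ≤ ε` (`Torus.exists_integral_norm_sq_linearisedField_sub_le` and the
interpolation `Torus.exists_forall_h2_sub_le_of_gevreyBound`). [folklore] -/
theorem exists_forall_l2_linearisedField_sub_le [Nonempty d] (ν σ Cu Cw : ℝ) (hσ : 0 < σ) {ε : ℝ} (hε : 0 < ε) :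
    ∃ δ : ℝ, 0 < δ ∧ ∀ (u₁ u₂ w₁ w₂ : UnitAddTorus d → EuclideanSpace ℝ d), IsSmooth u₁ → IsSmooth u₂ →
      IsSmooth w₁ → IsSmooth w₂ →
      (∀ S : Finset (d → ℤ), ∑ k ∈ S, Real.exp (2 * σ * Real.sqrt (freqNormSq k)) *
        ‖mFourierCoeff (EuclideanSpace.complexify ∘ u₁) k‖ ^ 2 ≤ Cu) →
      (∀ S : Finset (d → ℤ), ∑ k ∈ S, Real.exp (2 * σ * Real.sqrt (freqNormSq k)) *
        ‖mFourierCoeff (EuclideanSpace.complexify ∘ u₂) k‖ ^ 2 ≤ Cu) →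
      (∀ S : Finset (d → ℤ), ∑ k ∈ S, Real.exp (2 * σ * Real.sqrt (freqNormSq k)) *
        ‖mFourierCoeff (EuclideanSpace.complexify ∘ w₁) k‖ ^ 2 ≤ Cw) →
      (∀ S : Finset (d → ℤ), ∑ k ∈ S, Real.exp (2 * σ * Real.sqrt (freqNormSq k)) *
        ‖mFourierCoeff (EuclideanSpace.complexify ∘ w₂) k‖ ^ 2 ≤ Cw) →
      (∫ x, ‖u₁ x - u₂ x‖ ^ 2) ≤ δ → (∫ x, ‖w₁ x - w₂ x‖ ^ 2) ≤ δ →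
      (∫ x, ‖(ν • laplacian w₁ x - ((convect u₁ w₁ x + convect w₁ u₁ x) -
          Torus.gradient (invLaplacian (divergence fun y => convect u₁ w₁ y + convect w₁ u₁ y)) x)) -
        (ν • laplacian w₂ x - ((convect u₂ w₂ x + convect w₂ u₂ x) -
          Torus.gradient (invLaplacian (divergence fun y => convect u₂ w₂ y + convect w₂ u₂ y)) x))‖ ^ 2) ≤ ε := by
  obtain ⟨K, hK0, hK⟩ := exists_integral_norm_sq_linearisedField_sub_le (d := d) ν σ Cu Cw hσ
  have hη : 0 < ε / (5 * (K + 1)) := by positivity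
  obtain ⟨δu, hδu, hAu⟩ := exists_forall_h2_sub_le_of_gevreyBound (d := d) σ Cu hσ hη
  obtain ⟨δw, hδw, hAw⟩ := exists_forall_h2_sub_le_of_gevreyBound (d := d) σ Cw hσ hη
  refine ⟨min (ε / (5 * (K + 1))) (min δu δw), lt_min hη (lt_min hδu hδw),
    fun u₁ u₂ w₁ w₂ hu₁ hu₂ hw₁ hw₂ hGu₁ hGu₂ hGw₁ hGw₂ hLu hLw => ?_⟩
  obtain ⟨hEu, -⟩ := hAu u₁ u₂ hu₁ hu₂ hGu₁ hGu₂ (hLu.trans ((min_le_right _ _).trans (min_le_left _ _)))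
  obtain ⟨hEw, hYw⟩ := hAw w₁ w₂ hw₁ hw₂ hGw₁ hGw₂ (hLw.trans ((min_le_right _ _).trans (min_le_right _ _)))
  have hLu' := hLu.trans (min_le_left _ _)
  have hLw' := hLw.trans (min_le_left _ _)
  have h := hK u₁ u₂ w₁ w₂ hu₁ hu₂ hw₁ hw₂ hGu₁ hGu₂ hGw₁ hGw₂
  have hsum : (∫ x, ‖laplacian (fun y => w₁ y - w₂ y) x‖ ^ 2) + gradNormSq (fun y => w₁ y - w₂ y) +
      (∫ x, ‖w₁ x - w₂ x‖ ^ 2) + gradNormSq (fun y => u₁ y - u₂ y) + (∫ x, ‖u₁ x - u₂ x‖ ^ 2) ≤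
      5 * (ε / (5 * (K + 1))) := by linarith
  have hfin : K * (5 * (ε / (5 * (K + 1)))) ≤ ε := by
    rw [show K * (5 * (ε / (5 * (K + 1)))) = ε * (K / (K + 1)) by field_simp]
    exact mul_le_of_le_one_right hε.le ((div_le_one (by linarith)).2 (by linarith))
  exact h.trans ((mul_le_mul_of_nonneg_left hsum hK0).trans hfin)

/-- **The two time-derivative fields and their Laplacians are uniformly `L²`-continuous functions of the
state on a Gevrey ball of `T³`.** On `T^d` with `card d = 3`: for `ν`, `σ > 0`, `C`, a smooth force `f`
with `∑_{k∈S} e^{σ|k|} ‖f̂(k)‖² ≤ C_f`, and `ε > 0`, there is `δ > 0` such that for all smooth zero-mean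
`u₁, u₂` with Gevrey bounds `(σ, C)` and `∫‖u₁ − u₂‖² ≤ δ`, the fields `wᵢ = G(uᵢ) = νΔuᵢ − P((uᵢ·∇)uᵢ) + f`
and `Eᵢ = E(uᵢ, wᵢ) = νΔwᵢ − P((uᵢ·∇)wᵢ + (wᵢ·∇)uᵢ)` satisfy
`∫‖w₁ − w₂‖² ≤ ε`, `∫‖Δ(w₁ − w₂)‖² ≤ ε`, `∫‖E₁ − E₂‖² ≤ ε`, `∫‖Δ(E₁ − E₂)‖² ≤ ε` — along classical
solutions these are `∂ₜu` and `∂ₜ²u` (`Torus.IsClassicalNSSolutionOn.timeDerivWithin_eq_nsVectorField`,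
`Torus.eq_linearisedField_of_linearised`), so the first two time derivatives of a strong solution depend
continuously on the state in `H²` on Gevrey balls (Constantin–Foias 1988, Ch. 10–11; Foias–Temam 1989).
[folklore] -/
theorem exists_forall_nsTimeDerivFields_sub_le (hd : Fintype.card d = 3) (ν σ C Cf : ℝ) (hσ : 0 < σ)
    {f : UnitAddTorus d → EuclideanSpace ℝ d} (hf : IsSmooth f)
    (hGf : ∀ S : Finset (d → ℤ), ∑ k ∈ S, Real.exp (2 * (σ / 2) * Real.sqrt (freqNormSq k)) *
      ‖mFourierCoeff (EuclideanSpace.complexify ∘ f) k‖ ^ 2 ≤ Cf) {ε : ℝ} (hε : 0 < ε) :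
    ∃ δ : ℝ, 0 < δ ∧ ∀ (u₁ u₂ w₁ w₂ : UnitAddTorus d → EuclideanSpace ℝ d), IsSmooth u₁ → IsSmooth u₂ →
      HasZeroMean u₁ → HasZeroMean u₂ →
      (∀ S : Finset (d → ℤ), ∑ k ∈ S, Real.exp (2 * σ * Real.sqrt (freqNormSq k)) *
        ‖mFourierCoeff (EuclideanSpace.complexify ∘ u₁) k‖ ^ 2 ≤ C) →
      (∀ S : Finset (d → ℤ), ∑ k ∈ S, Real.exp (2 * σ * Real.sqrt (freqNormSq k)) *
        ‖mFourierCoeff (EuclideanSpace.complexify ∘ u₂) k‖ ^ 2 ≤ C) →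
      IsSmooth w₁ → IsSmooth w₂ →
      (∀ x, w₁ x = ν • laplacian u₁ x -
        (convect u₁ u₁ x - Torus.gradient (invLaplacian (divergence (convect u₁ u₁))) x) + f x) →
      (∀ x, w₂ x = ν • laplacian u₂ x -
        (convect u₂ u₂ x - Torus.gradient (invLaplacian (divergence (convect u₂ u₂))) x) + f x) →
      (∫ x, ‖u₁ x - u₂ x‖ ^ 2) ≤ δ →
      (∫ x, ‖w₁ x - w₂ x‖ ^ 2) ≤ ε ∧ (∫ x, ‖laplacian (fun y => w₁ y - w₂ y) x‖ ^ 2) ≤ ε ∧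
      (∫ x, ‖(ν • laplacian w₁ x - ((convect u₁ w₁ x + convect w₁ u₁ x) -
          Torus.gradient (invLaplacian (divergence fun y => convect u₁ w₁ y + convect w₁ u₁ y)) x)) -
        (ν • laplacian w₂ x - ((convect u₂ w₂ x + convect w₂ u₂ x) -
          Torus.gradient (invLaplacian (divergence fun y => convect u₂ w₂ y + convect w₂ u₂ y)) x))‖ ^ 2) ≤ ε ∧
      (∫ x, ‖laplacian (fun z => (ν • laplacian w₁ z - ((convect u₁ w₁ z + convect w₁ u₁ z) -
          Torus.gradient (invLaplacian (divergence fun y => convect u₁ w₁ y + convect w₁ u₁ y)) z)) -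
        (ν • laplacian w₂ z - ((convect u₂ w₂ z + convect w₂ u₂ z) -
          Torus.gradient (invLaplacian (divergence fun y => convect u₂ w₂ y + convect w₂ u₂ y)) z))) x‖ ^ 2) ≤ ε := by
  haveI : Nonempty d := Fintype.card_pos_iff.1 (by rw [hd]; norm_num)
  -- Gevrey levels of `w = G(u)` (radius `σ/2`) and of `E(u, w)` (radius `σ/4`)
  obtain ⟨C₁, hC₁⟩ := exists_gevreyBound_nsVectorField (d := d) ν σ C Cf hσ
  have hσ2 : 0 < σ / 2 := half_pos hσ
  obtain ⟨C₂, hC₂⟩ := exists_gevreyBound_linearisedField (d := d) ν (σ / 2) C C₁ hσ2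
  -- the chain of moduli
  obtain ⟨δ₄, hδ₄, h₄⟩ := exists_forall_h2_sub_le_of_gevreyBound (d := d) (σ / 2 / 2) C₂ (half_pos hσ2) hε
  obtain ⟨δ₃, hδ₃, h₃⟩ := exists_forall_l2_linearisedField_sub_le (d := d) ν (σ / 2) C C₁ hσ2 (lt_min hε hδ₄)
  obtain ⟨δ₂, hδ₂, h₂⟩ := exists_forall_h2_sub_le_of_gevreyBound (d := d) (σ / 2) C₁ hσ2 hε
  obtain ⟨δ₁, hδ₁, h₁⟩ := exists_forall_l2_nsVectorField_sub_le hd ν σ C hσ (lt_min hε (lt_min hδ₂ hδ₃))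
  refine ⟨min δ₁ δ₃, lt_min hδ₁ hδ₃, fun u₁ u₂ w₁ w₂ hu₁ hu₂ hm₁ hm₂ hG₁ hG₂ hw₁ hw₂ hw₁eq hw₂eq hL2 => ?_⟩
  -- Gevrey bounds of `wᵢ`, `uᵢ` at radius `σ/2`
  have hGw₁ : ∀ S : Finset (d → ℤ), ∑ k ∈ S, Real.exp (2 * (σ / 2) * Real.sqrt (freqNormSq k)) *
      ‖mFourierCoeff (EuclideanSpace.complexify ∘ w₁) k‖ ^ 2 ≤ C₁ := by
    rw [show w₁ = fun x => ν • laplacian u₁ x -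
        (convect u₁ u₁ x - Torus.gradient (invLaplacian (divergence (convect u₁ u₁))) x) + f x from funext hw₁eq]
    exact hC₁ u₁ f hu₁ hf hG₁ hGf
  have hGw₂ : ∀ S : Finset (d → ℤ), ∑ k ∈ S, Real.exp (2 * (σ / 2) * Real.sqrt (freqNormSq k)) *
      ‖mFourierCoeff (EuclideanSpace.complexify ∘ w₂) k‖ ^ 2 ≤ C₁ := by
    rw [show w₂ = fun x => ν • laplacian u₂ x -
        (convect u₂ u₂ x - Torus.gradient (invLaplacian (divergence (convect u₂ u₂))) x) + f x from funext hw₂eq]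
    exact hC₁ u₂ f hu₂ hf hG₂ hGf
  have hGu₁ := gevreyBound_mono_radius (σ' := σ / 2) (by linarith) hG₁
  have hGu₂ := gevreyBound_mono_radius (σ' := σ / 2) (by linarith) hG₂
  -- Step 1: `∫‖w₁ - w₂‖²` small (the force cancels)
  have hweq : ∀ x, w₁ x - w₂ x =
      (ν • laplacian u₁ x - (convect u₁ u₁ x - Torus.gradient (invLaplacian (divergence (convect u₁ u₁))) x)) -
        (ν • laplacian u₂ x - (convect u₂ u₂ x - Torus.gradient (invLaplacian (divergence (convect u₂ u₂))) x)) :=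
    fun x => by rw [hw₁eq x, hw₂eq x]; abel
  have hS1 : (∫ x, ‖w₁ x - w₂ x‖ ^ 2) ≤ min ε (min δ₂ δ₃) := by
    have h := h₁ u₁ u₂ hu₁ hu₂ hm₁ hm₂ hG₁ hG₂ (hL2.trans (min_le_left _ _))
    calc (∫ x, ‖w₁ x - w₂ x‖ ^ 2) = _ := by simp_rw [hweq]
      _ ≤ _ := h
  -- Step 2: `∫‖Δ(w₁ - w₂)‖²` small
  have hS2 := (h₂ w₁ w₂ hw₁ hw₂ hGw₁ hGw₂ (hS1.trans ((min_le_right _ _).trans (min_le_left _ _)))).2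
  -- Step 3: `∫‖E₁ - E₂‖²` small
  have hS3 := h₃ u₁ u₂ w₁ w₂ hu₁ hu₂ hw₁ hw₂ hGu₁ hGu₂ hGw₁ hGw₂ (hL2.trans (min_le_right _ _))
    (hS1.trans ((min_le_right _ _).trans (min_le_right _ _)))
  -- Step 4: `∫‖Δ(E₁ - E₂)‖²` small
  have hE₁ : IsSmooth (fun z => ν • laplacian w₁ z - ((convect u₁ w₁ z + convect w₁ u₁ z) -
      Torus.gradient (invLaplacian (divergence fun y => convect u₁ w₁ y + convect w₁ u₁ y)) z)) :=
    (hw₁.laplacian.smul ν).sub (isSmooth_sub_gradient_invLaplacian_divergence ((hu₁.convect hw₁).add (hw₁.convect hu₁)))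
  have hE₂ : IsSmooth (fun z => ν • laplacian w₂ z - ((convect u₂ w₂ z + convect w₂ u₂ z) -
      Torus.gradient (invLaplacian (divergence fun y => convect u₂ w₂ y + convect w₂ u₂ y)) z)) :=
    (hw₂.laplacian.smul ν).sub (isSmooth_sub_gradient_invLaplacian_divergence ((hu₂.convect hw₂).add (hw₂.convect hu₂)))
  have hS4 := (h₄ _ _ hE₁ hE₂ (hC₂ u₁ w₁ hu₁ hw₁ hGu₁ hGw₁) (hC₂ u₂ w₂ hu₂ hw₂ hGu₂ hGw₂)
    (hS3.trans (min_le_right _ _))).2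
  exact ⟨hS1.trans (min_le_left _ _), hS2, hS3.trans (min_le_left _ _), hS4⟩

end Continuity

end Torus

end Literature.Analysis.FluidPDE

end
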